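import Literature.AlgebraicTopology.SingularHomology.ProjectiveFibreStep
import Literature.AlgebraicTopology.SingularHomology.SubsetCochainsComparisonPull
import Literature.AlgebraicTopology.SingularHomology.SubsetCochainsEmbedding
import HarnessLib

/-!
# Transport of the Leray–Hirsch comparison maps: change of cocycles, of ambient space, of sets

Topic `Literature/AlgebraicTopology/SingularHomology`. D. Husemoller, *Fibre Bundles*, 3rd ed.
(1994), Ch. 17 §1, proof of the Leray–Hirsch theorem 1.1: the comparison maps
`θ_U(Σ cₖ xₖ) = Σ q*(cₖ) ⌣ aₖ` "only depend on the classes `aᵢ`" and are natural under maps of the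
total space; over a trivialising open set the statement is transported to the product
`U × F` ("for `E = B × F` the theorem is a direct consequence of the Künneth formula").
A. Hatcher, *Algebraic Topology* (2002), proof of Thm. 4D.1 p. 433 (the same reductions).

In the tree's setting (`H*_X(W)`, `cupRightH`, `pullH`, `pullT`, `lhMap`, `lhMapT`, `IsLHTR`) we
PROVE the bookkeeping used by the projective-bundle argument:

* `ActsZeroOn`, `SameActionOn` — the action of (families of) global cocycles on `H*_X(W)`;
  `lhMapT_congr` / `isLHTR_congr`: `θ` only depends on the actions; a coboundary acts by zero
  (`actsZeroOn_of_eq_d`), cohomologous cocycles act alike (`SimplexSpan.cupRightH_congr_of_sub_eq_d`);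
* **change of ambient space** along `i : X₂ → X₁` over `T` (`p₁ ∘ i = p₂`): `i* ∘ p₁* = p₂*`
  (`pullH_pullT`), `i*(θ₁ c) = θ₂ c` for `β₂ = i^♯β₁` (`pullH_lhMapT`), hence for `i*` bijective
  `IsLHTR` and `ActsZeroOn` are equivalent on the two sides (`isLHTR_iff_of_pullH`,
  `actsZeroOn_iff_of_pullH`);
* **the trivialised piece**: for `j : X' → X` over `U ⊆ B` (`q ∘ j = p'`) the comparison map `θ_U`
  of `q` with sources `H*_B(U)` is carried by `j*` to `θ` of `p' : X' → ↥U` with sources `H*(↥U)`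
  (`pullH_lhMap`), so `IsLHOn q U (q⁻¹U)` follows from `IsLHT p' univ` when `j*` is bijective
  (`isLHOn_of_isLHT`);
* **equal sets**: restriction along an equality of subsets is bijective (`resH_bijective_of_eq`),
  and `TwoSummand` / `IsLHTR` / `IsLHOn` are invariant (`TwoSummand.res_of_eq`, …).

Everything is proved; no named facts.

## References

* [HusemollerFibreBundles1994] D. Husemoller, *Fibre Bundles*, 3rd ed. (1994), Ch. 17 §1 Thm. 1.1.
* [HatcherAT2002] A. Hatcher, *Algebraic Topology*, CUP 2002, Thm. 4D.1 p. 433; §3.2 Prop. 3.10.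
-/

noncomputable section

-- as in `ProjectiveFibreStep`: chains of the concrete complex are `Finsupp`s up to unfolding of
-- semireducible definitions
set_option backward.isDefEq.respectTransparency false

open CategoryTheory Limits

universe u v

namespace Literature.AlgebraicTopology.SingularHomology

/-! ### Cohomologous cocycles act alike (any degree) -/

namespace SimplexSpan

variable {R : Type v} [CommRing R] {X : Type u} [TopologicalSpace X] (𝒮 : SimplexSpan R X)

/-- `⌣ β = ⌣ β'` on cohomology when `β - β' = δα`, in any degree `dd = e + 1` (the tree's
`cupRightH_congr` after substituting the degree). [cite: HatcherAT2002, Lemma 3.6] -/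
theorem cupRightH_congr_of_sub_eq_d (hS : 𝒮.FrontBackClosed) {p dd n : ℕ} (β β' : SingularSimplex X dd → R)
    (hβ : (singularCochainComplex R R X).d dd (dd + 1) β = 0)
    (hβ' : (singularCochainComplex R R X).d dd (dd + 1) β' = 0) (e : ℕ) (he : e + 1 = dd)
    (α : SingularSimplex X e → R) (hα : β - β' = (singularCochainComplex R R X).d e dd α)
    (h : p + dd = n) (x : 𝒮.cochains.homology p) :
    𝒮.cupRightH hS β hβ h x = 𝒮.cupRightH hS β' hβ' h x := by
  subst he
  exact 𝒮.cupRightH_congr hS β β' hβ hβ' α hα h x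

/-- `⌣ 0 = 0` on cohomology. [folklore] -/
theorem cupRightH_zero_cochain (hS : 𝒮.FrontBackClosed) {p dd n : ℕ}
    (h0 : (singularCochainComplex R R X).d dd (dd + 1) (0 : SingularSimplex X dd → R) = 0)
    (h : p + dd = n) (x : 𝒮.cochains.homology p) : 𝒮.cupRightH hS 0 h0 h x = 0 := by
  obtain ⟨ψ, hψ, rfl⟩ := homologyCls_surjective x
  rw [𝒮.cupRightH_homologyCls]
  exact (homologyCls_congr (subsetCochains.cupRight_zero_right 𝒮 h ψ) _ (by rw [map_zero])).trans
    (homologyCls_zero _)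

end SimplexSpan

namespace subsetCochains

variable {R : Type v} [CommRing R]

/-- Local notation: the coefficient object `ULift R` of `ModuleCat.{max u v} R`. -/
local notation "𝑹" => SimplexSpan.coefR R

/-! ### Actions of global cocycles on `H*_X(W)` -/

section Acts

variable {X : Type u} [TopologicalSpace X]

/-- **`β` acts by zero on `H*_X(W)`**: `y ⌣ β = 0` for every class `y` of the subset `W`. [folklore] -/
def ActsZeroOn {dd : ℕ} (β : SingularSimplex X dd → R)
    (hβ : (singularCochainComplex R R X).d dd (dd + 1) β = 0) (W : Set X) : Prop :=
  ∀ (m n : ℕ) (h : m + dd = n) (y : (subsetCochains R 𝑹 W).homology m),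
    (SimplexSpan.ofSet (R := R) W).cupRightH (SimplexSpan.frontBackClosed_ofSet _) β hβ h y = 0

/-- **A coboundary acts by zero** on every `H*_X(W)`. [cite: HatcherAT2002, Lemma 3.6] -/
theorem actsZeroOn_of_eq_d {dd : ℕ} (β : SingularSimplex X dd → R)
    (hβ : (singularCochainComplex R R X).d dd (dd + 1) β = 0) (e : ℕ) (he : e + 1 = dd)
    (α : SingularSimplex X e → R) (hα : β = (singularCochainComplex R R X).d e dd α) (W : Set X) :
    ActsZeroOn β hβ W := by
  intro m n h y
  have h0 : (singularCochainComplex R R X).d dd (dd + 1) (0 : SingularSimplex X dd → R) = 0 := map_zero _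
  rw [(SimplexSpan.ofSet (R := R) W).cupRightH_congr_of_sub_eq_d (SimplexSpan.frontBackClosed_ofSet _) β 0 hβ h0
    e he α (by rw [sub_zero, hα]) h y]
  exact (SimplexSpan.ofSet (R := R) W).cupRightH_zero_cochain _ h0 h y

/-- The zero cochain acts by zero. [folklore] -/
theorem actsZeroOn_zero {dd : ℕ} (h0 : (singularCochainComplex R R X).d dd (dd + 1) (0 : SingularSimplex X dd → R) = 0)
    (W : Set X) : ActsZeroOn 0 h0 W := fun _ _ h y ↦
  (SimplexSpan.ofSet (R := R) W).cupRightH_zero_cochain _ h0 h y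

variable {ι : Type} (d : ι → ℕ) (β β' : (k : ι) → SingularSimplex X (d k) → R)
  (hβ : ∀ k, (singularCochainComplex R R X).d (d k) (d k + 1) (β k) = 0)
  (hβ' : ∀ k, (singularCochainComplex R R X).d (d k) (d k + 1) (β' k) = 0)

/-- **Two families of cocycles act alike on `H*_X(W)`.** [folklore] -/
def SameActionOn (W : Set X) : Prop :=
  ∀ (k : ι) (m n : ℕ) (h : m + d k = n) (y : (subsetCochains R 𝑹 W).homology m),
    (SimplexSpan.ofSet (R := R) W).cupRightH (SimplexSpan.frontBackClosed_ofSet _) (β k) (hβ k) h y =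
      (SimplexSpan.ofSet (R := R) W).cupRightH (SimplexSpan.frontBackClosed_ofSet _) (β' k) (hβ' k) h y

/-- Families which are indexwise equal, or cohomologous in positive degree, act alike.
[cite: HatcherAT2002, Lemma 3.6] -/
theorem sameActionOn_of_cohomologous (W : Set X)
    (hc : ∀ k, β k = β' k ∨ ∃ (e : ℕ) (_ : e + 1 = d k) (α : SingularSimplex X e → R),
      β k - β' k = (singularCochainComplex R R X).d e (d k) α) :
    SameActionOn d β β' hβ hβ' W := by
  intro k m n h y
  rcases hc k with hk | ⟨e, he, α, hα⟩
  · exact LinearMap.congr_fun (cupRightH_congr_fun (SimplexSpan.ofSet (R := R) W)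
      (SimplexSpan.frontBackClosed_ofSet _) hk (hβ k) (hβ' k) h) y
  · exact (SimplexSpan.ofSet (R := R) W).cupRightH_congr_of_sub_eq_d _ _ _ (hβ k) (hβ' k) e he α hα h y

end Acts

/-! ### `θ` only depends on the actions of the cocycles -/

section Congr

variable {X T : Type u} [TopologicalSpace X] [TopologicalSpace T] (p : C(X, T)) {ι : Type} [Fintype ι]
  (d : ι → ℕ) (β β' : (k : ι) → SingularSimplex X (d k) → R)
  (hβ : ∀ k, (singularCochainComplex R R X).d (d k) (d k + 1) (β k) = 0)
  (hβ' : ∀ k, (singularCochainComplex R R X).d (d k) (d k + 1) (β' k) = 0)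

/-- **`θ` only depends on the actions of the `β k` on `H*_X(W)`** (Husemoller Ch. 17 §1: `θ`
depends only on the classes `aᵢ`). [cite: HusemollerFibreBundles1994, Ch. 17 §1 Thm. 1.1 (proof)] -/
theorem lhMapT_congr {W : Set X} (hW : SameActionOn d β β' hβ hβ' W) (n : ℕ) (c : SrcT (R := R) (T := T) d n) :
    lhMapT p d β hβ W n c = lhMapT p d β' hβ' W n c := by
  rw [lhMapT_apply, lhMapT_apply]
  exact Finset.sum_congr rfl fun s _ ↦ hW s.cls _ _ s.2 _

/-- `IsLHTR` only depends on the actions. [folklore] -/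
theorem isLHTR_congr {W : Set X} (hW : SameActionOn d β β' hβ hβ' W) (P : ι → Prop) :
    IsLHTR p d β hβ P W ↔ IsLHTR p d β' hβ' P W := by
  have key : ∀ (n : ℕ) (c : SrcT (R := R) (T := T) d n), lhMapT p d β hβ W n c = lhMapT p d β' hβ' W n c :=
    lhMapT_congr p d β β' hβ hβ' hW
  constructor
  · intro h n
    refine ⟨fun c hc h0 ↦ (h n).1 c hc (by rw [key, h0]), fun y ↦ ?_⟩
    obtain ⟨c, hc, rfl⟩ := (h n).2 y
    exact ⟨c, hc, (key n c).symm⟩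
  · intro h n
    refine ⟨fun c hc h0 ↦ (h n).1 c hc (by rw [← key, h0]), fun y ↦ ?_⟩
    obtain ⟨c, hc, rfl⟩ := (h n).2 y
    exact ⟨c, hc, key n c⟩

end Congr

/-! ### Change of the ambient space over the same parameter space -/

section Transport

variable {X₁ X₂ T : Type u} [TopologicalSpace X₁] [TopologicalSpace X₂] [TopologicalSpace T]
  (p₁ : C(X₁, T)) (p₂ : C(X₂, T)) (i : C(X₂, X₁)) (hp : p₁.comp i = p₂)
  {W₁ : Set X₁} {W₂ : Set X₂} (hW : Set.MapsTo i W₂ W₁)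

include hp in
/-- **`i* ∘ p₁* = p₂*` on base classes** for `p₁ ∘ i = p₂`. [cite: HatcherAT2002, §3.1 p. 199] -/
theorem pullH_pullT (e : ℕ) (a : singularCohomology R R T e) :
    pullH (N := 𝑹) i hW e (pullT p₁ W₁ e a) = pullT p₂ W₂ e a := by
  apply iso_injective
  rw [homologyIsoSingularCohomology_hom_pullH, iso_pullT, iso_pullT, ← ModuleCat.comp_apply,
    ← singularCohomology.map_comp]
  exact congrArg (fun f : C(↥W₂, T) ↦ singularCohomology.map R R f e a)
    (ContinuousMap.ext fun x ↦ ContinuousMap.congr_fun hp x.1)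

/-- `i*` of the unit class is the unit class (no compatibility needed). [folklore] -/
theorem pullH_pullT_one {T' : Type u} [TopologicalSpace T'] (p' : C(X₁, T')) :
    pullH (N := 𝑹) i hW 0 (pullT p' W₁ 0 (singularCohomology.one R T')) =
      pullT p₂ W₂ 0 (singularCohomology.one R T) := by
  apply iso_injective
  rw [homologyIsoSingularCohomology_hom_pullH, iso_pullT, iso_pullT, singularCohomology.map_one,
    singularCohomology.map_one, singularCohomology.map_one]

/-- **`i* ∘ q₁* = q₂* ∘ g*` on base classes** for a commutative square `q₁ ∘ i = g ∘ q₂` (change of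
parameter space as well). [cite: HatcherAT2002, §3.1 p. 199] -/
theorem pullH_pullT_of_comm {T₁' T₂' : Type u} [TopologicalSpace T₁'] [TopologicalSpace T₂'] (q₁ : C(X₁, T₁'))
    (q₂ : C(X₂, T₂')) (g : C(T₂', T₁')) (hq : q₁.comp i = g.comp q₂) (e : ℕ) (a : singularCohomology R R T₁' e) :
    pullH (N := 𝑹) i hW e (pullT q₁ W₁ e a) = pullT q₂ W₂ e (singularCohomology.map R R g e a) := by
  apply iso_injective
  rw [homologyIsoSingularCohomology_hom_pullH, iso_pullT, iso_pullT, ← ModuleCat.comp_apply,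
    ← singularCohomology.map_comp, ← ModuleCat.comp_apply, ← singularCohomology.map_comp]
  exact congrArg (fun f : C(↥W₂, T₁') ↦ singularCohomology.map R R f e a)
    (ContinuousMap.ext fun x ↦ ContinuousMap.congr_fun hq x.1)

variable {ι : Type} [Fintype ι] (d : ι → ℕ)
  (β₁ : (k : ι) → SingularSimplex X₁ (d k) → R) (hβ₁ : ∀ k, (singularCochainComplex R R X₁).d (d k) (d k + 1) (β₁ k) = 0)
  (β₂ : (k : ι) → SingularSimplex X₂ (d k) → R) (hβ₂ : ∀ k, (singularCochainComplex R R X₂).d (d k) (d k + 1) (β₂ k) = 0)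
  (hβ₁₂ : ∀ k, (singularCochainComplex.map R R i).f (d k) (β₁ k) = β₂ k)

include hp hβ₁₂ in
/-- **`i*(θ₁ c) = θ₂ c`**: the comparison maps of `(X₁, p₁, β₁)` over `W₁` are carried by `i*` to
those of `(X₂, p₂, i^♯β₁)` over `W₂` (Husemoller Ch. 17 §1: naturality of `θ`).
[cite: HusemollerFibreBundles1994, Ch. 17 §1 Thm. 1.1 (proof)] -/
theorem pullH_lhMapT (n : ℕ) (c : SrcT (R := R) (T := T) d n) :
    pullH (N := 𝑹) i hW n (lhMapT p₁ d β₁ hβ₁ W₁ n c) = lhMapT p₂ d β₂ hβ₂ W₂ n c := by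
  rw [lhMapT_apply, lhMapT_apply, map_sum]
  refine Finset.sum_congr rfl fun s _ ↦ ?_
  rw [pullH_cupRightH, pullH_pullT p₁ p₂ i hp]
  exact LinearMap.congr_fun (cupRightH_congr_fun (SimplexSpan.ofSet (R := R) W₂) (SimplexSpan.frontBackClosed_ofSet _)
    (hβ₁₂ s.cls) (map_d_eq_zero i _ (hβ₁ s.cls)) (hβ₂ s.cls) s.2) _

include hp hβ₁₂ in
/-- **`IsLHTR` is invariant under a change of ambient space inducing a bijection `i*`** (e.g. a
homotopy equivalence onto the piece, or an open embedding onto it).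
[cite: HusemollerFibreBundles1994, Ch. 17 §1 Thm. 1.1 (proof)] -/
theorem isLHTR_iff_of_pullH (hb : ∀ n, Function.Bijective (pullH (N := 𝑹) i hW n)) (P : ι → Prop) :
    IsLHTR p₁ d β₁ hβ₁ P W₁ ↔ IsLHTR p₂ d β₂ hβ₂ P W₂ := by
  have key := pullH_lhMapT p₁ p₂ i hp hW d β₁ hβ₁ β₂ hβ₂ hβ₁₂
  constructor
  · intro h n
    refine ⟨fun c hc h0 ↦ (h n).1 c hc ((hb n).1 ?_), fun y ↦ ?_⟩
    · rw [key, h0, map_zero]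
    · obtain ⟨y₁, rfl⟩ := (hb n).2 y
      obtain ⟨c, hc, rfl⟩ := (h n).2 y₁
      exact ⟨c, hc, (key n c).symm⟩
  · intro h n
    refine ⟨fun c hc h0 ↦ (h n).1 c hc ?_, fun y₁ ↦ ?_⟩
    · rw [← key, h0, map_zero]
    · obtain ⟨c, hc, hcy⟩ := (h n).2 (pullH (N := 𝑹) i hW n y₁)
      refine ⟨c, hc, (hb n).1 ?_⟩
      rw [key, hcy]

omit [Fintype ι] in
include hβ₁₂ in
/-- **`ActsZeroOn` is invariant under a change of ambient space inducing a bijection `i*`.** [folklore] -/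
theorem actsZeroOn_iff_of_pullH (hb : ∀ n, Function.Bijective (pullH (N := 𝑹) i hW n)) (k : ι) :
    ActsZeroOn (β₁ k) (hβ₁ k) W₁ ↔ ActsZeroOn (β₂ k) (hβ₂ k) W₂ := by
  have key : ∀ (m n : ℕ) (h : m + d k = n) (y : (subsetCochains R 𝑹 W₁).homology m),
      pullH (N := 𝑹) i hW n ((SimplexSpan.ofSet (R := R) W₁).cupRightH (SimplexSpan.frontBackClosed_ofSet _)
        (β₁ k) (hβ₁ k) h y) =
      (SimplexSpan.ofSet (R := R) W₂).cupRightH (SimplexSpan.frontBackClosed_ofSet _) (β₂ k) (hβ₂ k) h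
        (pullH (N := 𝑹) i hW m y) := fun m n h y ↦ by
    rw [pullH_cupRightH]
    exact LinearMap.congr_fun (cupRightH_congr_fun (SimplexSpan.ofSet (R := R) W₂) (SimplexSpan.frontBackClosed_ofSet _)
      (hβ₁₂ k) (map_d_eq_zero i _ (hβ₁ k)) (hβ₂ k) h) _
  constructor
  · intro h m n hmn y
    obtain ⟨y₁, rfl⟩ := (hb m).2 y
    rw [← key, h, map_zero]
  · intro h m n hmn y
    apply (hb n).1
    rw [key, h, map_zero]

end Transport

/-! ### The trivialised piece: sources `H*_B(U)` versus `H*(↥U)` -/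

section Local

variable {X B X' : Type u} [TopologicalSpace X] [TopologicalSpace B] [TopologicalSpace X']
  (q : C(X, B)) (U : Set B) (p' : C(X', ↥U)) (j : C(X', X)) (hqj : ∀ x, q (j x) = (p' x : B))
  {ι : Type} [Fintype ι] (d : ι → ℕ)
  (β : (k : ι) → SingularSimplex X (d k) → R) (hβ : ∀ k, (singularCochainComplex R R X).d (d k) (d k + 1) (β k) = 0)
  (β' : (k : ι) → SingularSimplex X' (d k) → R) (hβ' : ∀ k, (singularCochainComplex R R X').d (d k) (d k + 1) (β' k) = 0)
  (hββ' : ∀ k, (singularCochainComplex.map R R j).f (d k) (β k) = β' k)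

include hqj in
/-- `j` maps `X'` into `q⁻¹U`. [folklore] -/
theorem mapsTo_univ_preimage : Set.MapsTo j (Set.univ : Set X') (q ⁻¹' U) := fun x _ ↦ by
  change q (j x) ∈ U
  rw [hqj]
  exact (p' x).2

include hqj in
/-- **`j* ∘ q* = p'*` on base classes, through `H*_B(U) ≅ H*(↥U)`.** [cite: HatcherAT2002, §3.1 p. 199] -/
theorem pullH_pullH_eq_pullT (e : ℕ) (y : (subsetCochains R 𝑹 U).homology e) :
    pullH (N := 𝑹) j (mapsTo_univ_preimage q U p' j hqj) e (pullH (N := 𝑹) q (mapsTo_preimage_left q U) e y) =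
      pullT p' Set.univ e ((homologyIsoSingularCohomology R U e).hom y) := by
  have hqj' : Set.MapsTo (q.comp j) (Set.univ : Set X') U := fun x _ ↦ by
    change q (j x) ∈ U
    rw [hqj]
    exact (p' x).2
  rw [pullH_pullH j q (mapsTo_univ_preimage q U p' j hqj) (mapsTo_preimage_left q U) hqj']
  apply iso_injective
  rw [homologyIsoSingularCohomology_hom_pullH, iso_pullT]
  exact congrArg (fun f : C(↥(Set.univ : Set X'), ↥U) ↦ singularCohomology.map R R f e
      ((homologyIsoSingularCohomology R U e).hom y))
    (ContinuousMap.ext fun x ↦ Subtype.ext (hqj x.1))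

include hqj hββ' in
/-- **`j*(θ_U c) = θ'(iso ∘ c)`**: the comparison map of `q` over `U` (sources `H*_B(U)`) is
carried by `j*` to the comparison map of `p' : X' → ↥U` (sources `H*(↥U)`) for the cocycles
`j^♯β` (Husemoller Ch. 17 §1: reduction to the trivialised bundle).
[cite: HusemollerFibreBundles1994, Ch. 17 §1 Thm. 1.1 (proof)] -/
theorem pullH_lhMap (n : ℕ) (c : LHSubset.Src (R := R) d U n) :
    pullH (N := 𝑹) j (mapsTo_univ_preimage q U p' j hqj) n
        (LHSubset.lhMap q d β hβ U (q ⁻¹' U) (mapsTo_preimage_left q U) n c) =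
      lhMapT p' d β' hβ' Set.univ n (fun s ↦ (homologyIsoSingularCohomology R U s.deg).hom (c s)) := by
  rw [LHSubset.lhMap_apply, lhMapT_apply, map_sum]
  refine Finset.sum_congr rfl fun s _ ↦ ?_
  rw [pullH_cupRightH, pullH_pullH_eq_pullT q U p' j hqj]
  exact LinearMap.congr_fun (cupRightH_congr_fun (SimplexSpan.ofSet (R := R) (Set.univ : Set X'))
    (SimplexSpan.frontBackClosed_ofSet _) (hββ' s.cls) (map_d_eq_zero j _ (hβ s.cls)) (hβ' s.cls) s.2) _

include hqj hββ' in
/-- **Leray–Hirsch over `U` through `q⁻¹U` from Leray–Hirsch for the trivialised piece**: if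
`j* : H*_X(q⁻¹U) → H*_{X'}(X')` is bijective (e.g. `j` an open embedding onto `q⁻¹U`) and `θ'` is
bijective for `(X', p', j^♯β)`, then `θ_U` is bijective (Husemoller Ch. 17 §1).
[cite: HusemollerFibreBundles1994, Ch. 17 §1 Thm. 1.1 (proof)] -/
theorem isLHOn_of_isLHT (hjb : ∀ n, Function.Bijective (pullH (N := 𝑹) j (mapsTo_univ_preimage q U p' j hqj) n))
    (h : IsLHT p' d β' hβ' Set.univ) :
    LHSubset.IsLHOn q d β hβ U (q ⁻¹' U) (mapsTo_preimage_left q U) := by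
  have key := pullH_lhMap q U p' j hqj d β hβ β' hβ' hββ'
  have eU : ∀ e, Function.Bijective (homologyIsoSingularCohomology R U e).hom := fun e ↦
    (ConcreteCategory.isIso_iff_bijective (homologyIsoSingularCohomology R U e).hom).1 inferInstance
  intro n
  refine ⟨fun a ha ↦ ?_, fun z ↦ ?_⟩
  · have h1 : lhMapT p' d β' hβ' Set.univ n (fun s ↦ (homologyIsoSingularCohomology R U s.deg).hom (a s)) = 0 := by
      rw [← key, ha, map_zero]
    have h2 := (h n).1 _ h1
    funext s
    apply (eU s.deg).1
    have := congrFun h2 s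
    rw [Pi.zero_apply] at this
    rw [this, Pi.zero_apply, map_zero]
  · obtain ⟨c', hc'⟩ := (h n).2 (pullH (N := 𝑹) j (mapsTo_univ_preimage q U p' j hqj) n z)
    refine ⟨fun s ↦ (homologyIsoSingularCohomology R U s.deg).inv (c' s), (hjb n).1 ?_⟩
    rw [key, ← hc']
    congr 1
    funext s
    exact Iso.inv_hom_id_apply (homologyIsoSingularCohomology R U s.deg) (c' s)

end Local

/-! ### Equal subsets -/

section SetEq

variable {N : ModuleCat.{max u v} R} {X : Type u} [TopologicalSpace X]

/-- Restriction along the identity inclusion is the identity. [folklore] -/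
theorem resH_refl_apply {A : Set X} (h : A ⊆ A) (p : ℕ) (z : (subsetCochains R N A).homology p) :
    resH (N := N) h p z = z := by
  change (HomologicalComplex.homologyMap (res R N h) p) z = z
  rw [show res R N h = 𝟙 _ from res_refl (R := R) (N := N) A, HomologicalComplex.homologyMap_id]
  rfl

/-- **Restriction along an equality of subsets is bijective.** [folklore] -/
theorem resH_bijective_of_eq {A B : Set X} (h : A = B) (p : ℕ) :
    Function.Bijective (resH (N := N) h.subset p) := by
  subst h
  have key : ∀ z, resH (N := N) (Eq.subset rfl : A ⊆ A) p z = z := fun z ↦ resH_refl_apply _ p z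
  exact ⟨fun a b hab ↦ by rwa [key, key] at hab, fun b ↦ ⟨b, key b⟩⟩

variable {T : Type u} [TopologicalSpace T] (p : C(X, T))

/-- **`TwoSummand` is invariant under an equality of subsets** (transport by the restriction). [folklore] -/
theorem TwoSummand.res_of_eq {S S' : Set X} (h : S' = S) {M : ℕ}
    {s : (subsetCochains R (SimplexSpan.coefR R) S).homology M} (hS : TwoSummand p S M s) :
    TwoSummand p S' M (resH (N := SimplexSpan.coefR R) h.subset M s) := by
  subst h
  rwa [resH_refl_apply]

variable {ι : Type} [Fintype ι] (d : ι → ℕ) (β : (k : ι) → SingularSimplex X (d k) → R)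
  (hβ : ∀ k, (singularCochainComplex R R X).d (d k) (d k + 1) (β k) = 0)

/-- `IsLHTR` is invariant under an equality of subsets. [folklore] -/
theorem isLHTR_set_congr (P : ι → Prop) {W W' : Set X} (h : W = W') :
    IsLHTR p d β hβ P W ↔ IsLHTR p d β hβ P W' := by
  subst h
  exact Iff.rfl

/-- `ActsZeroOn` is invariant under an equality of subsets. [folklore] -/
theorem actsZeroOn_set_congr {dd : ℕ} (γ : SingularSimplex X dd → R)
    (hγ : (singularCochainComplex R R X).d dd (dd + 1) γ = 0) {W W' : Set X} (h : W = W') :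
    ActsZeroOn γ hγ W ↔ ActsZeroOn γ hγ W' := by
  subst h
  exact Iff.rfl

/-- `IsLHOn` is invariant under equalities of the subsets. [folklore] -/
theorem isLHOn_set_congr {B : Type u} [TopologicalSpace B] (q : C(X, B)) {U U' : Set B} {W W' : Set X}
    (hU : U = U') (hW : W = W') (h : Set.MapsTo q W U) (h' : Set.MapsTo q W' U') :
    LHSubset.IsLHOn q d β hβ U W h ↔ LHSubset.IsLHOn q d β hβ U' W' h' := by
  subst hU hW
  exact Iff.rfl

end SetEq

end subsetCochains

end Literature.AlgebraicTopology.SingularHomology
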